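import Literature.Geometry.Lorentzian.ExteriorRegion
import HarnessLib

/-!
# Slice boxes of embedded hypersurfaces and the barrier principle for minimal surfaces
(family `gr`, in support of **gr.S09**; namespace `Literature.GR`)

`ExteriorRegion.lean` reduces the connected-horizon Riemannian Penrose inequality
`riemannian_penrose_inequality_connected_smooth` (Huisken–Ilmanen, J. Differential Geom. 59
(2001)) to three named facts, one of which is the *boundary* strong maximum principle
`minimalSurface_boundary_maximumPrinciple`: a connected compact embedded minimal surface lying
outside an open region `U` with compact minimal boundary and touching `∂U` lies in `∂U`. This file
**proves** that fact from the classical *barrier (tangency) principle* for minimal surfaces,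
vendored in local slice-chart form, by a purely topological argument which is itself proved
here in the generality of smoothly embedded hypersurfaces `Σ = f(S)` of an `(n+1)`-manifold:

* `exists_sliceBox` — **theorem** (slice box): around any point `f z₀` of a smoothly embedded
  hypersurface there are a chart `ψ` of the maximal `C^∞` atlas, a linear straightening
  `T : ℝⁿ⁺¹ ≃ ℝⁿ × ℝ` and an open box `O ∋ f z₀` inside the chart domain such that
  `range f ∩ O` is exactly the coordinate slice `{x ∈ O | (T (ψ x)).2 = 0}` and the two open
  half-boxes `{(T (ψ x)).2 > 0}`, `{(T (ψ x)).2 < 0}` of `O` are preconnected, with `f z₀` in the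
  closure of each (Lee 2013, Thm. 5.8 and Prop. 5.2: embedded submanifolds satisfy the local
  slice condition, and the image of a chart domain of `S` is open in `range f`). It is extracted
  from Mathlib's slice-chart definition of immersions (`Manifold.IsImmersionAt`: charts in which
  `f` reads `u ↦ equiv (u, 0)` for a complement `F`, here a line) and the topological-embedding
  half of `Manifold.IsSmoothEmbedding`;
* `minimalSurface_barrierPrinciple` — **named fact**, the barrier principle for minimal surfaces
  in a Riemannian `3`-manifold in slice-chart form: if an embedded minimal surface `Σ₁` is the
  coordinate slice `{x³ = 0}` of a box `O`, and a connected open piece `f₂(W)` of an embedded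
  minimal surface lies in the closed half-box `{x³ ≤ 0}` and touches `Σ₁`, then `f₂(W) ⊆ Σ₁`
  (Eschenburg 1989; Jorge–Tomi 2003; Solomon–White 1989 as printed in White 2010, Thm. 4;
  Andersson–Galloway–Howard 1998, Thm. 3.10);
* `minimalSurface_boundary_maximumPrinciple_of_barrierPrinciple` — **theorem**: the barrier
  principle implies `minimalSurface_boundary_maximumPrinciple`. In a slice box `O` of `∂U` at a
  touching point, `U ∩ O` misses the slice and is relatively closed in each half-box (its
  limit points off `U` lie in `∂U`, the slice), so by preconnectedness each half-box lies in `U`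
  or misses it, and not both miss it (`U` accumulates at the touching point). If the upper
  half-box lies in `U`, the touching surface, which misses `U`, lies in the closed lower half-box,
  and the barrier principle applies to the component of the touching point in `f ⁻¹' O` (open, as
  surfaces are locally connected); if the lower one does, the same after reversing the height
  coordinate. Hence `f ⁻¹' (∂U)` is open; it is closed and nonempty, so it is all of the
  connected surface;
* `riemannian_penrose_inequality_connected_smooth_of_barrierPrinciple` — the reduction of
  `ExteriorRegion.lean` with the maximum principle discharged:
  `exteriorRegion_structure → riemannian_penrose_inequality_exteriorRegion →
  minimalSurface_barrierPrinciple → riemannian_penrose_inequality_connected_smooth`.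

## Mathlib

Used: `Manifold.IsSmoothEmbedding` (`isImmersion`, `isEmbedding`), `Manifold.IsImmersionAt`
with its data `complement`, `equiv : (E × complement) ≃L E'`, `domChart`, `codChart`,
`writtenInCharts`, `codChart_mem_maximalAtlas`, `source_subset_preimage_source`
(`Mathlib/Geometry/Manifold/Immersion.lean`); `Topology.IsInducing.isOpen_iff`;
`OpenPartialHomeomorph` API; `ContinuousLinearEquiv.ofFinrankEq`, `prodCongr`, `neg`;
`Convex.isPreconnected`, `convex_ball`, `convex_halfSpace_lt/gt`;
`IsPreconnected.subset_of_closure_inter_subset`; `connectedComponentIn`,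
`IsOpen.connectedComponentIn` with `ChartedSpace.locallyConnectedSpace`;
`ContinuousWithinAt.mem_closure_image`. Mathlib has no maximum principle for (quasilinear)
elliptic equations and no minimal-surface theory, whence the named fact.

## Design choices

* *Slice-chart form of "lies on one side".* The barrier principle is vendored with the barrier
  `Σ₁` presented as a coordinate slice `{x ∈ O | (T (ψ x)).2 = 0}` of an open subset `O` of the
  domain of a chart `ψ` of the maximal atlas (composed with a linear isomorphism
  `T : E3 ≃L ℝ² × ℝ`), and "`Σ₂` lies locally on one side of `Σ₁`" as
  `f₂ '' W ⊆ {x ∈ O | (T (ψ x)).2 ≤ 0}`; then `N = {x ∈ O | (T (ψ x)).2 ≤ 0}` is literally a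
  Riemannian `3`-manifold with boundary `∂N = Σ₁ ∩ O`, mean convex because minimal, and `f₂ '' W`
  a connected minimal surface in `N`, which is the setting of the printed barrier principle. No
  derivative of a defining function is mentioned, so the topological reduction needs no calculus.
* *Hypersurfaces of any dimension for the slice box* (`𝓡 n`-manifolds in `𝓡 (n+1)`-manifolds):
  the complement of Mathlib's immersion data is shown to be a line by a dimension count and
  identified with `ℝ` (`SliceBox.complementEquivReal`); everything else is chart bookkeeping.
  The minimal-surface statements stay in dimension `2 ⊂ 3`, the setting of `ExteriorRegion.lean`.
* *Faithfulness.* The named fact carries the hypotheses of the printed barrier principle (both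
  surfaces smooth — here with the honest `H = 0` of `Hypersurface.lean` for *smooth* unit normals,
  embedded, the touching piece connected) and asserts its conclusion; compactness and
  completeness are not required by the source and not assumed.

## References

* J.-H. Eschenburg, *Maximum principle for hypersurfaces*, Manuscripta Math. 64 (1989) 55–75
  (Thm. 1 and the barrier principle for hypersurfaces; cited for "a short proof" of the
  classical barrier principle in Gama–de Lira–Mari–de Medeiros, J. London Math. Soc. 105 (2022),
  p. 3 of arXiv:2004.08946).
* L. P. Jorge, F. Tomi, *The barrier principle for minimal submanifolds of arbitrary
  codimension*, Ann. Global Anal. Geom. 24 (2003) 261–267 (as stated in White 2010, p. 1: "if `N`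
  is `m`-convex at all boundary points, then a smooth, connected minimal `m`-dimensional
  submanifold cannot touch `∂N` unless it lies entirely in `∂N`").
* B. Solomon, B. White, *A strong maximum principle for varifolds that are stationary with
  respect to even parametric elliptic functionals*, Indiana Univ. Math. J. 38 (1989) 683–691;
  B. White, *The maximum principle for minimal varieties of arbitrary codimension*, Comm. Anal.
  Geom. 18 (2010) 421–432 (arXiv:0906.0189), Thm. 4.
* E. S. Gama, J. H. S. de Lira, L. Mari, A. A. de Medeiros, *A barrier principle at infinity for
  varifolds with bounded mean curvature*, J. Lond. Math. Soc. (2) 105 (2022) 308–342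
  (arXiv:2004.08946), p. 3 (the classical barrier principle and its two-surface form, as quoted
  in the docstring of `minimalSurface_barrierPrinciple`).
* L. Andersson, G. J. Galloway, R. Howard, Comm. Pure Appl. Math. 51 (1998) 581–624, Thm. 3.10.
* J. M. Lee, *Introduction to Smooth Manifolds*, 2nd ed., Springer 2013, Thm. 5.8, Prop. 5.2.
* G. Huisken, T. Ilmanen, J. Differential Geom. 59 (2001) 353–437, §4 (proof of Lemma 4.1) and
  §6 (proof of Thm. 6.1: "`∂F` is disjoint from `∂W` by the strong maximum principle").
-/

noncomputable section

open Bundle Set Manifold TopologicalSpace Filter Function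
open scoped ContDiff Topology Manifold

namespace Literature.Geometry.Lorentzian

open PseudoRiemannianMetric

/-! ### Slice boxes of smoothly embedded hypersurfaces -/

namespace SliceBox

variable {n : ℕ} {S : Type*} [TopologicalSpace S] [ChartedSpace (EuclideanSpace ℝ (Fin n)) S]
  {X : Type*} [TopologicalSpace X] [ChartedSpace (EuclideanSpace ℝ (Fin (n + 1))) X]
  {f : S → X} {z₀ : S}

/-- The complement in Mathlib's immersion data of a hypersurface is finite-dimensional (it is a
direct summand of `ℝⁿ⁺¹`). [folklore] -/
lemma finiteDimensional_complement (hi : IsImmersionAt (𝓡 n) (𝓡 (n + 1)) ∞ f z₀) :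
    FiniteDimensional ℝ hi.complement := by
  haveI : Module.Finite ℝ (EuclideanSpace ℝ (Fin n) × hi.complement) :=
    Module.Finite.equiv hi.equiv.toLinearEquiv.symm
  exact Module.Finite.of_injective (LinearMap.inr ℝ (EuclideanSpace ℝ (Fin n)) hi.complement)
    LinearMap.inr_injective

/-- The complement in Mathlib's immersion data of a hypersurface is a line:
`n + dim F = n + 1`. [folklore] -/
lemma finrank_complement (hi : IsImmersionAt (𝓡 n) (𝓡 (n + 1)) ∞ f z₀) :
    Module.finrank ℝ hi.complement = 1 := by
  haveI := finiteDimensional_complement hi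
  have h := hi.equiv.toLinearEquiv.finrank_eq
  rw [Module.finrank_prod, finrank_euclideanSpace_fin, finrank_euclideanSpace_fin] at h
  omega

/-- A linear identification of the (one-dimensional) complement with `ℝ`. [folklore] -/
def complementEquivReal (hi : IsImmersionAt (𝓡 n) (𝓡 (n + 1)) ∞ f z₀) :
    hi.complement ≃L[ℝ] ℝ :=
  haveI := finiteDimensional_complement hi
  ContinuousLinearEquiv.ofFinrankEq (by rw [finrank_complement hi, Module.finrank_self])

/-- The **straightening** `ℝⁿ⁺¹ ≃L ℝⁿ × ℝ` attached to the immersion data at `z₀`: the inverse of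
Mathlib's `equiv : ℝⁿ × F ≃L ℝⁿ⁺¹` followed by `F ≃L ℝ`. In the coordinates `T ∘ codChart` the
hypersurface is the slice `{last coordinate = 0}`. [folklore] -/
def straighten (hi : IsImmersionAt (𝓡 n) (𝓡 (n + 1)) ∞ f z₀) :
    EuclideanSpace ℝ (Fin (n + 1)) ≃L[ℝ] EuclideanSpace ℝ (Fin n) × ℝ :=
  hi.equiv.symm.trans
    ((ContinuousLinearEquiv.refl ℝ (EuclideanSpace ℝ (Fin n))).prodCongr (complementEquivReal hi))

/-- Unfolding lemma: `T (equiv (a, c)) = (a, c)` read through `F ≃ ℝ`. [folklore] -/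
@[simp]
lemma straighten_equiv (hi : IsImmersionAt (𝓡 n) (𝓡 (n + 1)) ∞ f z₀)
    (a : EuclideanSpace ℝ (Fin n)) (c : hi.complement) :
    straighten hi (hi.equiv (a, c)) = (a, complementEquivReal hi c) := by
  simp [straighten]

/-- **In the codomain chart `f` reads `z ↦ equiv (φ z, 0)`** on the source of the domain chart
(Mathlib's `writtenInCharts`, unwound for the boundaryless models `𝓡 n`, `𝓡 (n+1)`). [folklore] -/
lemma codChart_apply (hi : IsImmersionAt (𝓡 n) (𝓡 (n + 1)) ∞ f z₀) {z : S}
    (hz : z ∈ hi.domChart.source) :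
    hi.codChart (f z) = hi.equiv (hi.domChart z, 0) := by
  have hmem : (hi.domChart.extend (𝓡 n)) z ∈ (hi.domChart.extend (𝓡 n)).target :=
    (hi.domChart.extend (𝓡 n)).map_source (by rw [OpenPartialHomeomorph.extend_source]; exact hz)
  have hw := hi.writtenInCharts hmem
  simp only [comp_apply] at hw
  rw [OpenPartialHomeomorph.extend_left_inv _ hz] at hw
  have h1 : (hi.codChart.extend (𝓡 (n + 1))) (f z) = hi.codChart (f z) := by
    rw [OpenPartialHomeomorph.extend_coe, comp_apply, modelWithCornersSelf_coe, id]
  have h2 : (hi.domChart.extend (𝓡 n)) z = hi.domChart z := by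
    rw [OpenPartialHomeomorph.extend_coe, comp_apply, modelWithCornersSelf_coe, id]
  rw [h1, h2] at hw
  exact hw

/-- In straightened coordinates `f` reads `z ↦ (φ z, 0)`. [folklore] -/
lemma straighten_codChart_apply (hi : IsImmersionAt (𝓡 n) (𝓡 (n + 1)) ∞ f z₀) {z : S}
    (hz : z ∈ hi.domChart.source) :
    straighten hi (hi.codChart (f z)) = (hi.domChart z, 0) := by
  rw [codChart_apply hi hz, straighten_equiv, map_zero]

/-- Pulling a set of straightened coordinates back to `X`: for `C` whose unstraightened image lies
in the chart target, `(ψ⁻¹ ∘ T⁻¹) '' C = {x ∈ ψ.source | T (ψ x) ∈ C}`. [folklore] -/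
lemma image_symm_eq (hi : IsImmersionAt (𝓡 n) (𝓡 (n + 1)) ∞ f z₀)
    {C : Set (EuclideanSpace ℝ (Fin n) × ℝ)}
    (hC : (straighten hi).symm '' C ⊆ hi.codChart.target) :
    (hi.codChart.symm ∘ (straighten hi).symm) '' C =
      {x | x ∈ hi.codChart.source ∧ straighten hi (hi.codChart x) ∈ C} := by
  ext x
  constructor
  · rintro ⟨q, hq, rfl⟩
    have hqt : (straighten hi).symm q ∈ hi.codChart.target := hC (mem_image_of_mem _ hq)
    refine ⟨hi.codChart.map_target hqt, ?_⟩
    simp only [comp_apply, hi.codChart.right_inv hqt, ContinuousLinearEquiv.apply_symm_apply]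
    exact hq
  · rintro ⟨hx, hxC⟩
    refine ⟨straighten hi (hi.codChart x), hxC, ?_⟩
    simp only [comp_apply, ContinuousLinearEquiv.symm_apply_apply, hi.codChart.left_inv hx]

/-- The centre `(a, 0)` of a box `ball (a, 0) r` lies in the closure of each of its open halves
`{q.2 > 0}`, `{q.2 < 0}` (approach along the vertical segment). [folklore] -/
lemma center_mem_closure_half {a : EuclideanSpace ℝ (Fin n)} {r : ℝ} (hr : 0 < r) (pos : Bool) :
    (a, (0 : ℝ)) ∈ closure (Metric.ball (a, (0 : ℝ)) r ∩
      {q : EuclideanSpace ℝ (Fin n) × ℝ | if pos then 0 < q.2 else q.2 < 0}) := by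
  -- the vertical segment `t ↦ (a, t)` over `(0, r)` resp. `(-r, 0)` lies in the half-box
  set γ : ℝ → EuclideanSpace ℝ (Fin n) × ℝ := fun t ↦ (a, t) with hγ
  have hγc : Continuous γ := continuous_const.prodMk continuous_id
  set I : Set ℝ := if pos then Ioo 0 r else Ioo (-r) 0 with hI
  have h0 : (0 : ℝ) ∈ closure I := by
    cases pos
    · simp only [hI, Bool.false_eq_true, ↓reduceIte, closure_Ioo (neg_lt_zero.mpr hr).ne]
      exact ⟨by linarith, le_rfl⟩
    · simp only [hI, ↓reduceIte, closure_Ioo hr.ne]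
      exact ⟨le_rfl, hr.le⟩
  have hsub : γ '' I ⊆ Metric.ball (a, (0 : ℝ)) r ∩ {q | if pos then 0 < q.2 else q.2 < 0} := by
    rintro _ ⟨t, ht, rfl⟩
    refine ⟨?_, ?_⟩
    · rw [Metric.mem_ball, Prod.dist_eq, dist_self, Real.dist_0_eq_abs]
      cases pos
      · simp only [hI, Bool.false_eq_true, ↓reduceIte, mem_Ioo] at ht
        exact max_lt hr (abs_lt.mpr ⟨by linarith, by linarith⟩)
      · simp only [hI, ↓reduceIte, mem_Ioo] at ht
        exact max_lt hr (abs_lt.mpr ⟨by linarith, by linarith⟩)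
    · cases pos
      · simp only [hI, Bool.false_eq_true, ↓reduceIte, mem_Ioo] at ht
        simpa [hγ] using ht.2
      · simp only [hI, ↓reduceIte, mem_Ioo] at ht
        simpa [hγ] using ht.1
  have : γ 0 ∈ closure (γ '' I) := hγc.continuousWithinAt.mem_closure_image h0
  exact closure_mono hsub this

end SliceBox

open SliceBox in
/-- **Slice box of a smoothly embedded hypersurface.** Let `f : S → X` be a smooth (`C^∞`)
embedding of an `n`-manifold into an `(n+1)`-manifold (models `𝓡 n`, `𝓡 (n+1)`) and `z₀ ∈ S`.
There are a chart `ψ` of `X` in the maximal `C^∞` atlas, a continuous linear isomorphism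
`T : ℝⁿ⁺¹ ≃ ℝⁿ × ℝ` and an open set `O ∋ f z₀` with `O ⊆ ψ.source` such that, writing
`x³ := (T (ψ x)).2` for the last straightened coordinate:
`range f ∩ O = {x ∈ O | x³ = 0}` (inside the box the hypersurface is *exactly* the coordinate
slice — this uses that `f` is a topological embedding, not only an injective immersion), the open
half-boxes `{x ∈ O | x³ > 0}` and `{x ∈ O | x³ < 0}` are preconnected, and `f z₀` lies in the
closure of each. (`O` is the pull-back of a small ball around `(φ z₀, 0)` in the straightened
chart, `φ` the domain slice chart.) Lee 2013, Thm. 5.8 (local `k`-slice condition for embedded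
submanifolds) with Prop. 5.2; here derived from Mathlib's slice-chart definition of immersions.
[cite: LeeSmoothManifolds2013, Thm. 5.8 and Prop. 5.2] -/
theorem exists_sliceBox {n : ℕ} {S : Type*} [TopologicalSpace S]
    [ChartedSpace (EuclideanSpace ℝ (Fin n)) S]
    {X : Type*} [TopologicalSpace X] [ChartedSpace (EuclideanSpace ℝ (Fin (n + 1))) X]
    {f : S → X} (hf : IsSmoothEmbedding (𝓡 n) (𝓡 (n + 1)) ∞ f) (z₀ : S) :
    ∃ (ψ : OpenPartialHomeomorph X (EuclideanSpace ℝ (Fin (n + 1))))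
      (T : EuclideanSpace ℝ (Fin (n + 1)) ≃L[ℝ] EuclideanSpace ℝ (Fin n) × ℝ) (O : Set X),
      ψ ∈ IsManifold.maximalAtlas (𝓡 (n + 1)) ∞ X ∧ IsOpen O ∧ f z₀ ∈ O ∧ O ⊆ ψ.source ∧
      range f ∩ O = {x | x ∈ O ∧ (T (ψ x)).2 = 0} ∧
      IsPreconnected {x | x ∈ O ∧ 0 < (T (ψ x)).2} ∧
      IsPreconnected {x | x ∈ O ∧ (T (ψ x)).2 < 0} ∧
      f z₀ ∈ closure {x | x ∈ O ∧ 0 < (T (ψ x)).2} ∧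
      f z₀ ∈ closure {x | x ∈ O ∧ (T (ψ x)).2 < 0} := by
  have hi : IsImmersionAt (𝓡 n) (𝓡 (n + 1)) ∞ f z₀ := hf.isImmersion.isImmersionAt z₀
  set φ := hi.domChart with hφ
  set ψ := hi.codChart with hψ
  set T := straighten hi with hT
  -- an open set of `X` cutting out the source of the domain chart (`f` is an embedding)
  obtain ⟨Wo, hWo, hWo_pre⟩ := hf.isEmbedding.isInducing.isOpen_iff.mp φ.open_source
  have hz₀φ : z₀ ∈ φ.source := hi.mem_domChart_source
  have hpψ : f z₀ ∈ ψ.source := hi.mem_codChart_source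
  have hTp : T (ψ (f z₀)) = (φ z₀, 0) := straighten_codChart_apply hi hz₀φ
  -- the admissible region in straightened coordinates
  set G : Set (EuclideanSpace ℝ (Fin n) × ℝ) :=
    T.symm ⁻¹' (ψ.target ∩ ψ.symm ⁻¹' Wo) ∩ Prod.fst ⁻¹' φ.target with hG_def
  have hG : IsOpen G :=
    ((ψ.isOpen_inter_preimage_symm hWo).preimage T.symm.continuous).inter
      (φ.open_target.preimage continuous_fst)
  have hG₀ : (φ z₀, (0 : ℝ)) ∈ G := by
    refine ⟨?_, φ.map_source hz₀φ⟩
    show T.symm (φ z₀, 0) ∈ ψ.target ∩ ψ.symm ⁻¹' Wo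
    rw [← hTp, ContinuousLinearEquiv.symm_apply_apply]
    refine ⟨ψ.map_source hpψ, ?_⟩
    rw [mem_preimage, ψ.left_inv hpψ, ← mem_preimage, hWo_pre]
    exact hz₀φ
  obtain ⟨r, hr, hball⟩ := Metric.isOpen_iff.mp hG _ hG₀
  -- the box and its pull-back `O`
  set Bx : Set (EuclideanSpace ℝ (Fin n) × ℝ) := Metric.ball (φ z₀, (0 : ℝ)) r with hBx
  have hBxT : T.symm '' Bx ⊆ ψ.target := by
    rintro _ ⟨q, hq, rfl⟩
    exact (hball hq).1.1
  have hsubT : ∀ C ⊆ Bx, T.symm '' C ⊆ ψ.target := fun C hC ↦ (image_mono hC).trans hBxT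
  set O : Set X := {x | x ∈ ψ.source ∧ T (ψ x) ∈ Bx} with hO
  have hO_open : IsOpen O :=
    (T.continuous.comp_continuousOn ψ.continuousOn).isOpen_inter_preimage ψ.open_source
      Metric.isOpen_ball
  have hOWo : O ⊆ Wo := by
    rintro x ⟨hx, hxB⟩
    have h1 := (hball hxB).1
    simp only [mem_preimage, ContinuousLinearEquiv.symm_apply_apply, mem_inter_iff] at h1
    rw [ψ.left_inv hx] at h1
    exact h1.2
  -- the half-boxes as images of convex sets under `ψ⁻¹ ∘ T⁻¹`
  have himage : ∀ P : EuclideanSpace ℝ (Fin n) × ℝ → Prop,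
      {x | x ∈ O ∧ P (T (ψ x))} = (ψ.symm ∘ T.symm) '' (Bx ∩ {q | P q}) := by
    intro P
    rw [image_symm_eq hi (hsubT _ inter_subset_left)]
    ext x; simp only [mem_setOf_eq, mem_inter_iff, hO]; tauto
  have hcont : ∀ C ⊆ Bx, ContinuousOn (ψ.symm ∘ T.symm) C := fun C hC ↦
    ψ.continuousOn_symm.comp T.symm.continuous.continuousOn
      (fun q hq ↦ hsubT C hC (mem_image_of_mem _ hq))
  have hclos : ∀ pos : Bool, f z₀ ∈ closure
      {x | x ∈ O ∧ if pos then 0 < (T (ψ x)).2 else (T (ψ x)).2 < 0} := by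
    intro pos
    rw [himage (fun q ↦ if pos then 0 < q.2 else q.2 < 0)]
    have hx₀ : f z₀ = (ψ.symm ∘ T.symm) (φ z₀, 0) := by
      rw [comp_apply, ← hTp, ContinuousLinearEquiv.symm_apply_apply, ψ.left_inv hpψ]
    rw [hx₀]
    refine ContinuousWithinAt.mem_closure_image ?_ (center_mem_closure_half hr pos)
    refine ((hcont Bx subset_rfl).continuousWithinAt ?_).mono inter_subset_left
    exact Metric.mem_ball_self hr
  refine ⟨ψ, T, O, hi.codChart_mem_maximalAtlas, hO_open,
    ⟨hpψ, by rw [hTp]; exact Metric.mem_ball_self hr⟩, fun x hx ↦ hx.1, ?_, ?_, ?_,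
    by simpa using hclos true, by simpa using hclos false⟩
  · -- `range f ∩ O` is the coordinate slice
    ext x
    constructor
    · rintro ⟨⟨z, rfl⟩, hxO⟩
      have hz : z ∈ φ.source := by rw [← hWo_pre]; exact hOWo hxO
      exact ⟨hxO, by rw [straighten_codChart_apply hi hz]⟩
    · rintro ⟨hxO, hx0⟩
      have hq : T (ψ x) = ((T (ψ x)).1, 0) := Prod.ext rfl hx0
      have ha : (T (ψ x)).1 ∈ φ.target := (hball hxO.2).2
      set z := φ.symm (T (ψ x)).1 with hz
      have hzs : z ∈ φ.source := φ.map_target ha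
      have hfz : f z ∈ ψ.source := hi.source_subset_preimage_source hzs
      have hTz : T (ψ (f z)) = T (ψ x) := by
        rw [straighten_codChart_apply hi hzs, hq, hz, φ.right_inv ha]
      exact ⟨⟨z, ψ.injOn hfz hxO.1 (T.injective hTz)⟩, hxO⟩
  · -- the upper half-box is preconnected
    rw [himage (fun q ↦ 0 < q.2)]
    exact ((convex_ball _ _).inter
      (convex_halfSpace_gt (LinearMap.snd ℝ _ ℝ).isLinear 0)).isPreconnected.image _
        (hcont _ inter_subset_left)
  · -- the lower half-box is preconnected
    rw [himage (fun q ↦ q.2 < 0)]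
    exact ((convex_ball _ _).inter
      (convex_halfSpace_lt (LinearMap.snd ℝ _ ℝ).isLinear 0)).isPreconnected.image _
        (hcont _ inter_subset_left)

/-! ### The barrier principle for minimal surfaces (slice-chart form) -/

/-- **Barrier (tangency) principle for minimal surfaces, slice-chart form** (named fact). The
classical statement (Eschenburg, Manuscripta Math. 64 (1989); in arbitrary codimension
Jorge–Tomi, Ann. Global Anal. Geom. 24 (2003), as reported in White 2010, p. 1: *if `N` is a
Riemannian manifold with boundary which is `m`-convex at all boundary points, then a smooth,
connected minimal `m`-dimensional submanifold of `N` cannot touch `∂N` unless it lies entirely in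
`∂N`*; for hypersurfaces `m = dim N - 1`, `m`-convex means mean convex, `H_{∂N} · ν_in ≥ 0`, and
the varifold version is Solomon–White 1989 = White, Comm. Anal. Geom. 18 (2010), Thm. 4: *`N`
mean convex along a connected open `U ⊆ ∂N`, `V` an `m`-varifold minimising area to first order
in `N`; if `spt V` contains a point of `U` it contains all of `U`*; the `C⁰`-graph version is
Andersson–Galloway–Howard 1998, Thm. 3.10). Equivalently (Gama–de Lira–Mari–de Medeiros 2022,
p. 3): *a connected minimal hypersurface with image inside a mean convex set `Ω` cannot touch `∂Ω`
unless it lies in `∂Ω`; two connected minimal hypersurfaces touching at `p`, one locally on one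
side of the other near `p`, coincide.* Vendored for surfaces in a Riemannian `3`-manifold
`(X, h)` in the following local form. Let `Σ₁ = range f₁` be a smoothly embedded minimal surface
(`H = 0` for a *smooth* unit normal, `IsMaximalSlice`) which, inside an open subset `O` of the
domain of a chart `ψ` of the maximal `C^∞` atlas composed with a linear isomorphism
`T : E3 ≃ ℝ² × ℝ`, is exactly the coordinate slice: `range f₁ ∩ O = {x ∈ O | (T (ψ x)).2 = 0}`.
Let `f₂ : S₂ → X` be another smoothly embedded minimal surface and `W ⊆ S₂` open and
preconnected with `f₂ '' W ⊆ N := {x ∈ O | (T (ψ x)).2 ≤ 0}` (so `N` is a smooth Riemannian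
`3`-manifold with boundary `∂N = Σ₁ ∩ O`, minimal hence mean convex for either normal, and
`f₂ '' W` is a connected smooth minimal surface in `N`). If `f₂ '' W` meets `Σ₁` (touches `∂N`),
then `f₂ '' W ⊆ Σ₁`. The standing hypotheses `hpbᵢ`, `[HasLeviCivita]` are those of
`Hypersurface.lean`; compactness and completeness are not assumed (the source does not).
[cite: Eschenburg1989, Thm. 1 and its proof (barrier principle for hypersurfaces)]
[cite: JorgeTomi2003, barrier principle (as stated in White 2010, p. 1)]
[cite: White2009, Thm. 4 (Solomon–White 1989)]
[cite: GamaEtAl2022, p. 3 (statement of the classical barrier principle)]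
[cite: AnderssonGallowayHoward1998, Thm. 3.10] -/
def minimalSurface_barrierPrinciple : Prop :=
  ∀ (X : Type) [TopologicalSpace X] [ChartedSpace E3 X] [IsManifold (𝓡 3) ∞ X] [T2Space X]
    [SecondCountableTopology X]
    (h : ContMDiffRiemannianMetric (𝓡 3) ∞ E3 (TangentSpace (𝓡 3) : X → Type _))
    [(ofRiemannian h).HasLeviCivita]
    (S₁ : Type) [TopologicalSpace S₁] [ChartedSpace (EuclideanSpace ℝ (Fin 2)) S₁]
    [IsManifold (𝓡 2) ∞ S₁] [T2Space S₁]
    (f₁ : S₁ → X) (ν₁ : NormalField (𝓡 3) f₁) (hpb₁ : contMDiff_pullbackBilin (𝓡 3) X (𝓡 2) S₁ ∞)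
    (hf₁ : (ofRiemannian h).IsSpacelikeImmersion (𝓡 2) f₁),
    Manifold.IsSmoothEmbedding (𝓡 2) (𝓡 3) ∞ f₁ → (ofRiemannian h).IsUnitNormal (𝓡 2) f₁ ν₁ 1 →
    ContMDiff (𝓡 2) (𝓡 3).tangent ∞
      (fun y ↦ (TotalSpace.mk' E3 (f₁ y) (ν₁ y) : TangentBundle (𝓡 3) X)) →
    (ofRiemannian h).IsMaximalSlice f₁ hpb₁ hf₁ ν₁ →
    ∀ (S₂ : Type) [TopologicalSpace S₂] [ChartedSpace (EuclideanSpace ℝ (Fin 2)) S₂]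
      [IsManifold (𝓡 2) ∞ S₂] [T2Space S₂]
      (f₂ : S₂ → X) (ν₂ : NormalField (𝓡 3) f₂)
      (hpb₂ : contMDiff_pullbackBilin (𝓡 3) X (𝓡 2) S₂ ∞)
      (hf₂ : (ofRiemannian h).IsSpacelikeImmersion (𝓡 2) f₂),
    Manifold.IsSmoothEmbedding (𝓡 2) (𝓡 3) ∞ f₂ → (ofRiemannian h).IsUnitNormal (𝓡 2) f₂ ν₂ 1 →
    ContMDiff (𝓡 2) (𝓡 3).tangent ∞
      (fun y ↦ (TotalSpace.mk' E3 (f₂ y) (ν₂ y) : TangentBundle (𝓡 3) X)) →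
    (ofRiemannian h).IsMaximalSlice f₂ hpb₂ hf₂ ν₂ →
    ∀ (ψ : OpenPartialHomeomorph X E3) (T : E3 ≃L[ℝ] EuclideanSpace ℝ (Fin 2) × ℝ) (O : Set X)
      (W : Set S₂),
    ψ ∈ IsManifold.maximalAtlas (𝓡 3) ∞ X → IsOpen O → O ⊆ ψ.source →
    range f₁ ∩ O = {x | x ∈ O ∧ (T (ψ x)).2 = 0} →
    IsOpen W → IsPreconnected W → f₂ '' W ⊆ {x | x ∈ O ∧ (T (ψ x)).2 ≤ 0} →
    (f₂ '' W ∩ range f₁).Nonempty → f₂ '' W ⊆ range f₁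

/-! ### The boundary maximum principle from the barrier principle -/

/-- **The boundary maximum principle for minimal surfaces, proved from the barrier principle.**
`minimalSurface_barrierPrinciple → minimalSurface_boundary_maximumPrinciple`: let `U ⊆ X` be
open with compact minimal boundary `∂U = range B.f`, and `f : S₀ → X` a smooth embedding of a
compact connected surface, minimal with smooth unit normal, with `range f ∩ U = ∅` and
`range f ∩ ∂U ≠ ∅`; then `range f ⊆ ∂U`. Proof. `A = f ⁻¹' (∂U)` is closed and nonempty; it is
open: at `y₀ ∈ A` take a slice box `O` of the embedded surface `∂U` at `f y₀` (`exists_sliceBox`),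
with slice `∂U ∩ O` and preconnected half-boxes `H₊`, `H₋`. A preconnected subset of `O` of
non-zero height meeting `U` lies in `U` (`IsPreconnected.subset_of_closure_inter_subset`: its
points in `closure U ∖ U = ∂U` would lie in the slice), and `U` meets `O` (as `f y₀ ∈ closure U`)
in a point of non-zero height (`U ∩ ∂U = ∅`). If `H₊ ⊆ U`, then `f`, which misses `U`, maps the
component `W` of `y₀` in `f ⁻¹' O` (open: surfaces are locally connected) into the closed lower
half-box, touching the slice at `f y₀`, so `f '' W ⊆ ∂U` by the barrier principle and `W ⊆ A`;
if `H₋ ⊆ U`, the same with the height reversed (`T` composed with `(u, t) ↦ (u, -t)`); one of the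
two holds. Huisken–Ilmanen 2001 use exactly this in §4 and §6 ("`∂F` is disjoint from `∂W` by
the strong maximum principle"). [cite: HuiskenIlmanenIMCF2001, §6 proof of Thm. 6.1]
[cite: Eschenburg1989, Thm. 1] -/
theorem minimalSurface_boundary_maximumPrinciple_of_barrierPrinciple
    (hbar : minimalSurface_barrierPrinciple) : minimalSurface_boundary_maximumPrinciple := by
  intro X _ _ _ _ _ h _ U B S₀ _ _ _ _ _ _ f ν hpb hf hemb hunit hν hmin hdisj hmeet
  haveI : LocallyConnectedSpace S₀ :=
    ChartedSpace.locallyConnectedSpace (EuclideanSpace ℝ (Fin 2)) S₀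
  have hBU : Disjoint (range B.f) (U : Set X) :=
    Set.disjoint_iff_inter_eq_empty.mpr (B.range_inter_eq_empty U.isOpen)
  -- `A = f ⁻¹' ∂U` is clopen and nonempty in the connected `S₀`
  suffices hA : IsClopen (f ⁻¹' range B.f) by
    obtain ⟨x, ⟨y, rfl⟩, hx⟩ := hmeet
    rcases isClopen_iff.mp hA with h0 | huniv
    · exact absurd h0 (Set.nonempty_iff_ne_empty.mp ⟨y, hx⟩)
    · rintro _ ⟨y', rfl⟩
      exact (huniv.symm ▸ mem_univ y' : y' ∈ f ⁻¹' range B.f)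
  refine ⟨(B.isCompact_range.isClosed).preimage hemb.isEmbedding.continuous, ?_⟩
  rw [isOpen_iff_mem_nhds]
  rintro y₀ ⟨z₀, hz₀⟩
  -- a slice box of `∂U = range B.f` at `f y₀ = B.f z₀`
  obtain ⟨ψ, T, O, hψ, hO, hpO, hOψ, hplane, hconnp, hconnm, -, -⟩ :=
    exists_sliceBox B.isEmbedding z₀
  rw [hz₀] at hpO
  -- a preconnected set of non-zero height inside `O` meeting `U` lies in `U`
  have key : ∀ H : Set X, H ⊆ O → IsPreconnected H → (∀ x ∈ H, (T (ψ x)).2 ≠ 0) →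
      (H ∩ U).Nonempty → H ⊆ U := by
    intro H hHO hH hH0 hne
    refine hH.subset_of_closure_inter_subset U.isOpen hne ?_
    rintro x ⟨hxU, hxH⟩
    by_contra hx
    have hfr : x ∈ frontier (U : Set X) := ⟨hxU, by rwa [U.isOpen.interior_eq]⟩
    rw [B.frontier_eq] at hfr
    have hx0 : x ∈ range B.f ∩ O := ⟨hfr, hHO hxH⟩
    rw [hplane] at hx0
    exact hH0 x hxH hx0.2
  have hkeyp := key {x | x ∈ O ∧ 0 < (T (ψ x)).2} (fun x hx ↦ hx.1) hconnp
    (fun x hx ↦ ne_of_gt hx.2)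
  have hkeym := key {x | x ∈ O ∧ (T (ψ x)).2 < 0} (fun x hx ↦ hx.1) hconnm
    (fun x hx ↦ ne_of_lt hx.2)
  -- `U` meets `O` (as `f y₀ ∈ ∂U ⊆ closure U`), in a point of non-zero height
  have hpfr : f y₀ ∈ frontier (U : Set X) := by rw [B.frontier_eq]; exact ⟨z₀, hz₀⟩
  obtain ⟨x₁, hx₁O, hx₁U⟩ : (O ∩ (U : Set X)).Nonempty :=
    mem_closure_iff.mp (frontier_subset_closure hpfr) O hO hpO
  have hx₁0 : (T (ψ x₁)).2 ≠ 0 := by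
    intro h0
    have : x₁ ∈ range B.f ∩ O := by rw [hplane]; exact ⟨hx₁O, h0⟩
    exact Set.disjoint_left.mp hBU this.1 hx₁U
  -- `range f` misses `U`
  have hfU : ∀ y, f y ∉ (U : Set X) := fun y hy ↦ Set.disjoint_left.mp hdisj ⟨y, rfl⟩ hy
  -- the component `W` of `y₀` in `f ⁻¹' O`
  set W := connectedComponentIn (f ⁻¹' O) y₀ with hW
  have hWopen : IsOpen W := (hO.preimage hemb.isEmbedding.continuous).connectedComponentIn
  have hWconn : IsPreconnected W := isPreconnected_connectedComponentIn
  have hWO : W ⊆ f ⁻¹' O := connectedComponentIn_subset _ _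
  have hyW : y₀ ∈ W := mem_connectedComponentIn hpO
  have hWmeet : (f '' W ∩ range B.f).Nonempty := ⟨f y₀, mem_image_of_mem f hyW, z₀, hz₀⟩
  have hWnhds : W ∈ 𝓝 y₀ := hWopen.mem_nhds hyW
  by_cases hp : ({x | x ∈ O ∧ 0 < (T (ψ x)).2} ∩ (U : Set X)).Nonempty
  · -- the upper half-box lies in `U`, so `f '' W` lies in the closed lower half-box
    have hWle : f '' W ⊆ {x | x ∈ O ∧ (T (ψ x)).2 ≤ 0} := by
      rintro _ ⟨y, hy, rfl⟩
      exact ⟨hWO hy, le_of_not_gt fun hlt ↦ hfU y (hkeyp hp ⟨hWO hy, hlt⟩)⟩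
    have hsub := hbar X h B.surf B.f B.ν B.hpb B.isSpacelikeImmersion B.isEmbedding
      B.isUnitNormal B.contMDiff_normal B.isMinimal S₀ f ν hpb hf hemb hunit hν hmin ψ T O W
      hψ hO hOψ hplane hWopen hWconn hWle hWmeet
    exact Filter.mem_of_superset hWnhds fun y hy ↦ hsub (mem_image_of_mem f hy)
  by_cases hm : ({x | x ∈ O ∧ (T (ψ x)).2 < 0} ∩ (U : Set X)).Nonempty
  · -- the lower half-box lies in `U`: reverse the height coordinate
    set T' : E3 ≃L[ℝ] EuclideanSpace ℝ (Fin 2) × ℝ :=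
      T.trans ((ContinuousLinearEquiv.refl ℝ _).prodCongr (ContinuousLinearEquiv.neg ℝ)) with hT'
    have hT'2 : ∀ v, (T' v).2 = -(T v).2 := fun v ↦ by simp [hT']
    have hplane' : range B.f ∩ O = {x | x ∈ O ∧ (T' (ψ x)).2 = 0} := by
      rw [hplane]; ext x; simp [hT'2]
    have hWle : f '' W ⊆ {x | x ∈ O ∧ (T' (ψ x)).2 ≤ 0} := by
      rintro _ ⟨y, hy, rfl⟩
      refine ⟨hWO hy, ?_⟩
      rw [hT'2, neg_nonpos]
      exact le_of_not_gt fun hlt ↦ hfU y (hkeym hm ⟨hWO hy, hlt⟩)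
    have hsub := hbar X h B.surf B.f B.ν B.hpb B.isSpacelikeImmersion B.isEmbedding
      B.isUnitNormal B.contMDiff_normal B.isMinimal S₀ f ν hpb hf hemb hunit hν hmin ψ T' O W
      hψ hO hOψ hplane' hWopen hWconn hWle hWmeet
    exact Filter.mem_of_superset hWnhds fun y hy ↦ hsub (mem_image_of_mem f hy)
  · -- neither half-box meets `U`: impossible, `x₁ ∈ U ∩ O` has non-zero height
    exfalso
    rcases lt_or_gt_of_ne hx₁0 with hlt | hgt
    · exact hm ⟨x₁, ⟨hx₁O, hlt⟩, hx₁U⟩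
    · exact hp ⟨x₁, ⟨hx₁O, hgt⟩, hx₁U⟩

/-- **gr.S09, connected horizon, with the maximum principle discharged.** The named facts
`exteriorRegion_structure` (Huisken–Ilmanen 2001, Lemma 4.1),
`riemannian_penrose_inequality_exteriorRegion` (their Main Theorem for exterior regions) and
the barrier principle for minimal surfaces `minimalSurface_barrierPrinciple` imply
`riemannian_penrose_inequality_connected_smooth`
(`riemannian_penrose_inequality_connected_smooth_of_exteriorRegion` with
`minimalSurface_boundary_maximumPrinciple_of_barrierPrinciple`).
[cite: HuiskenIlmanenIMCF2001, Main Theorem, Lemma 4.1 and §8 step 1] -/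
theorem riemannian_penrose_inequality_connected_smooth_of_barrierPrinciple
    (h1 : exteriorRegion_structure) (h2 : riemannian_penrose_inequality_exteriorRegion)
    (hbar : minimalSurface_barrierPrinciple) :
    riemannian_penrose_inequality_connected_smooth :=
  riemannian_penrose_inequality_connected_smooth_of_exteriorRegion h1 h2
    (minimalSurface_boundary_maximumPrinciple_of_barrierPrinciple hbar)

end Literature.Geometry.Lorentzian

end
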